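import Summits.HodgeConjecture.HodgeConjecture.Theses.NikulinTwinTransport
import Literature.AlgebraicGeometry.Surfaces.K3PeriodSurjectivityProofs
import Literature.AlgebraicGeometry.Surfaces.K3TwistorLines
import Literature.AlgebraicGeometry.Surfaces.PolarisedK3TwinKuranishiFamily

/-!
# Ideator-2 sketch for crux `K3PeriodSurjective` (stmt-HodgeConjecture-15154), round 1

First lemmas of the three idea cards (`ergodic-shioda-inose`, `two-adic-isogeny-bootstrap`,
`kulikov-properness`), typed over existing declarations. Stubs are `sorry`; the two composition
theorems record the intended glue (also `sorry` here — no skeleton at the ideation stage).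
-/

noncomputable section

open scoped Matrix
open Literature.AlgebraicGeometry Literature.AlgebraicGeometry.Surfaces
open Literature.AlgebraicTopology.SingularHomology

namespace Summit.HodgeConjecture.HodgeConjecture.Cruxes.K3PeriodSurjective.IdeatorTwoSketch

/-! ### Common vocabulary -/

/-- `Realised x`: the conclusion of the crux at the period vector `x` — a projective K3 surface with
a marking under which `x` spans `H^{2,0}` (literally `∃ S, IsK3Surface S ∧ IsMarkedK3 S φ p x`). -/
def Realised (x : K3Index → ℂ) : Prop :=
  ∃ (S : Motives.SchemeOver ℂ) (_ : IsK3Surface S)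
    (φ : HodgeTheory.complexBetti S (2 * 1) ≃ₗ[ℂ] (K3Index → ℂ))
    (p : HodgeTheory.complexBetti S (2 * 2)), IsMarkedK3 S φ p x

/-- The three hypotheses of the crux: `x` is a PROJECTIVE period vector. -/
def IsProjectivePeriod (x : K3Index → ℂ) : Prop :=
  k3Form x x = 0 ∧ 0 < (k3Form (star x) x).re ∧
    ∃ v : K3Index → ℤ, k3Form (fun i => (v i : ℂ)) x = 0 ∧ 0 < ∑ i, ∑ j, v i * k3Gram i j * v j

/-- Sanity: the crux IS `∀ x, hypotheses → Realised x`, definitionally. -/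
theorem crux_iff :
    Theses.NikulinTwinTransport.K3PeriodSurjective ↔
      ∀ x : K3Index → ℂ, k3Form x x = 0 → 0 < (k3Form (star x) x).re →
        (∃ v : K3Index → ℤ, k3Form (fun i => (v i : ℂ)) x = 0 ∧
          0 < ∑ i, ∑ j, v i * k3Gram i j * v j) → Realised x :=
  Iff.rfl

/-- Integral isometries `O(Λ_{K3})` as matrices. -/
def IsLatticeIsometry (g : Matrix K3Index K3Index ℤ) : Prop :=
  g.transpose * k3Gram * g = k3Gram

/-- Rational isometries `O(Λ_{K3} ⊗ ℚ)` as matrices. -/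
def IsRatIsometry (g : Matrix K3Index K3Index ℚ) : Prop :=
  g.transpose * k3Gram.map (Int.cast : ℤ → ℚ) * g = k3Gram.map (Int.cast : ℤ → ℚ)

/-- `g ∈ M₂₂(ℤ[1/2])`: all entries are dyadic rationals. With `IsRatIsometry` this is the
`2`-arithmetic group `O(Λ[1/2])` (its inverse `Λ⁻¹ gᵀ Λ` is again dyadic, `Λ` being unimodular). -/
def IsTwoIntegral (g : Matrix K3Index K3Index ℚ) : Prop :=
  ∀ i j, ∃ (m : ℤ) (k : ℕ), g i j = (m : ℚ) / 2 ^ k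

/-- SINGULAR (Shioda–Inose) period vectors: `s = a + i·t·b` with `a, b ∈ Λ`, `(a.b) = 0`,
`a² > 0`, `b² > 0`, `t > 0`, `t² b² = a²` — exactly the period vectors whose positive plane
`⟨Re s, Im s⟩` is RATIONAL (Picard number 20; Huybrechts Ch. 14 Cor. 3.21). -/
def singularPeriodVectors : Set (K3Index → ℂ) :=
  {s | ∃ (a b : K3Index → ℤ) (t : ℝ), 0 < t ∧
      (∑ i, ∑ j, a i * k3Gram i j * b j) = 0 ∧
      0 < (∑ i, ∑ j, a i * k3Gram i j * a j) ∧
      t ^ 2 * ((∑ i, ∑ j, b i * k3Gram i j * b j : ℤ) : ℝ) = ((∑ i, ∑ j, a i * k3Gram i j * a j : ℤ) : ℝ) ∧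
      s = fun i => ((a i : ℝ) : ℂ) + ((t * (b i : ℝ) : ℝ) : ℂ) * Complex.I}

/-! ### Card 1 `ergodic-shioda-inose`: Ratner/Verbitsky orbit closures + singular K3 anchors -/

/-- (E2′) FIRST LEMMA of card 1 — **every `O(Λ)·ℂˣ`-orbit closure in the period quadric contains a
singular period vector** (Verbitsky 2015 Thm. 4.8 + erratum arXiv:1708.05802 Thm. 2.5, via Ratner;
Bakker–Lehn arXiv:1812.09748 Prop. 72: the three orbit types rrk = 0, 1, 2 — in each case the closure
contains a rational positive plane). Pure homogeneous dynamics of `O(3,19;ℤ)`; no K3 geometry. -/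
theorem stub_orbitClosure_contains_singular :
    ∀ x ∈ k3PeriodDomain, ∃ s ∈ singularPeriodVectors, ∀ ε : ℝ, 0 < ε →
      ∃ (g : Matrix K3Index K3Index ℤ) (c : ℂ), IsLatticeIsometry g ∧ c ≠ 0 ∧
        dist (c • (g.map (Int.cast : ℤ → ℂ) *ᵥ x)) s < ε := by
  sorry

/-- (E4) **Shioda–Inose**: every singular period vector is realised by a projective (ρ = 20) K3
surface — the explicit double cover of `Km(E₁ × E₂)`, `E_i = ℂ/(ℤ + τ_iℤ)` CM curves
(Shioda–Inose 1977; Huybrechts Ch. 14 Cor. 3.21, Rem. 3.22; marking extended by Nikulin, Cor. 14.3.10). -/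
theorem stub_singular_realised : ∀ s ∈ singularPeriodVectors, Realised s := by
  sorry

/-- (E1′) **Local openness at a realised singular point** (Kuranishi family of the singular K3 +
local Torelli, Huybrechts Ch. 6 Cor. 2.7 / Prop. 2.8; projectivity criterion Ch. 1 §3 = BHPV IV.6.2;
Chow/GAGA): every PROJECTIVE period vector close enough to a realised singular one is realised. -/
theorem stub_localOpenness_at_singular :
    ∀ s ∈ singularPeriodVectors, Realised s → ∃ ε : ℝ, 0 < ε ∧
      ∀ x : K3Index → ℂ, IsProjectivePeriod x → dist x s < ε → Realised x := by
  sorry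

/-- COMPOSITION of card 1 (ergodicity replaces compactness): E1′ + E2′ + E4 ⇒ the crux, by the
`O(Λ) × ℂˣ`-invariance of hypotheses and conclusion already PROVED in the tree
(`Huybrechts_K3_periodSurjective_projective.conclusion_smul / conclusion_of_latticeIsometry /
hypotheses_smul / hypotheses_of_latticeIsometry`, `isUnit_of_k3Isometry`). Glue only; to be proved
at crux-plan. -/
theorem K3PeriodSurjective_of_ergodic
    (h1 : ∀ s ∈ singularPeriodVectors, Realised s → ∃ ε : ℝ, 0 < ε ∧
      ∀ x : K3Index → ℂ, IsProjectivePeriod x → dist x s < ε → Realised x)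
    (h2 : ∀ x ∈ k3PeriodDomain, ∃ s ∈ singularPeriodVectors, ∀ ε : ℝ, 0 < ε →
      ∃ (g : Matrix K3Index K3Index ℤ) (c : ℂ), IsLatticeIsometry g ∧ c ≠ 0 ∧
        dist (c • (g.map (Int.cast : ℤ → ℂ) *ᵥ x)) s < ε)
    (h4 : ∀ s ∈ singularPeriodVectors, Realised s) :
    Theses.NikulinTwinTransport.K3PeriodSurjective := by
  rw [crux_iff]
  intro x hxx hpos hv
  obtain ⟨s, hs, hclos⟩ := h2 x ⟨hxx, hpos⟩
  obtain ⟨ε, hε, hloc⟩ := h1 s hs (h4 s hs)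
  obtain ⟨g, c, hg, hc, hdist⟩ := hclos ε hε
  -- `y := c • g x` is again a projective period vector (invariance of the hypotheses, in tree)
  have hy : IsProjectivePeriod (c • (g.map (Int.cast : ℤ → ℂ) *ᵥ x)) := by
    obtain ⟨h1', h2', h3'⟩ :=
      Huybrechts_K3_periodSurjective_projective.hypotheses_of_latticeIsometry hg hxx hpos hv
    exact Huybrechts_K3_periodSurjective_projective.hypotheses_smul hc h1' h2' h3'
  -- local openness at the singular anchor `s`
  have hRy : Realised (c • (g.map (Int.cast : ℤ → ℂ) *ᵥ x)) := hloc _ hy hdist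
  -- unscale by `c⁻¹`
  have hRg : Realised (g.map (Int.cast : ℤ → ℂ) *ᵥ x) := by
    have h' := Huybrechts_K3_periodSurjective_projective.conclusion_smul (t := c⁻¹)
      (inv_ne_zero hc) hRy
    rwa [smul_smul, inv_mul_cancel₀ hc, one_smul] at h'
  -- pull back along `g⁻¹ ∈ O(Λ)`
  obtain ⟨u, rfl⟩ := isUnit_of_k3Isometry hg
  have hg' : IsLatticeIsometry (↑u⁻¹ : Matrix K3Index K3Index ℤ) := by
    unfold IsLatticeIsometry at hg ⊢
    set gm : Matrix K3Index K3Index ℤ := (u : Matrix K3Index K3Index ℤ) with hgm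
    set gi : Matrix K3Index K3Index ℤ := (↑u⁻¹ : Matrix K3Index K3Index ℤ) with hgi
    have hinv : gm * gi = 1 := u.mul_inv
    calc gi.transpose * k3Gram * gi
        = gi.transpose * (gm.transpose * k3Gram * gm) * gi := by rw [hg]
      _ = (gm * gi).transpose * k3Gram * (gm * gi) := by
          rw [Matrix.transpose_mul]
          simp only [Matrix.mul_assoc]
      _ = k3Gram := by rw [hinv, Matrix.transpose_one, Matrix.one_mul, Matrix.mul_one]
  have hR := Huybrechts_K3_periodSurjective_projective.conclusion_of_latticeIsometry hg'
    (Units.isUnit u⁻¹) hRg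
  have hcast : (↑u⁻¹ : Matrix K3Index K3Index ℤ).map (Int.cast : ℤ → ℂ) *
      (↑u : Matrix K3Index K3Index ℤ).map (Int.cast : ℤ → ℂ) = 1 := by
    have h := congrArg (Int.castRingHom ℂ).mapMatrix u.inv_mul
    rw [map_mul, map_one] at h
    simpa only [RingHom.mapMatrix_apply, Int.coe_castRingHom] using h
  rwa [Matrix.mulVec_mulVec, hcast, Matrix.one_mulVec] at hR

/-! ### Rational isometries act on `Λ_ℂ` (companions of the tree's integral lemmas) -/

/-- `ℚ`-matrices followed by `ℚ ↪ ℂ` compose with `ℤ ↪ ℚ`. [folklore] -/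
theorem ratCast_map_intCast_map (M : Matrix K3Index K3Index ℤ) :
    (M.map (Int.cast : ℤ → ℚ)).map (Rat.cast : ℚ → ℂ) = M.map (Int.cast : ℤ → ℂ) := by
  ext i j
  simp only [Matrix.map_apply, Rat.cast_intCast]

/-- A rational isometry of `Λ_ℚ` preserves the `ℂ`-bilinear K3 form. [folklore] -/
theorem k3Form_ratMulVec_of_isometry {g : Matrix K3Index K3Index ℚ} (hg : IsRatIsometry g)
    (a b : K3Index → ℂ) :
    k3Form (g.map (Rat.cast : ℚ → ℂ) *ᵥ a) (g.map (Rat.cast : ℚ → ℂ) *ᵥ b) = k3Form a b := by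
  have hC : (g.map (Rat.cast : ℚ → ℂ)).transpose * k3Gram.map (Int.cast : ℤ → ℂ) *
      g.map (Rat.cast : ℚ → ℂ) = k3Gram.map (Int.cast : ℤ → ℂ) := by
    have h := congrArg (Rat.castHom ℂ).mapMatrix hg
    rw [map_mul, map_mul] at h
    simpa only [RingHom.mapMatrix_apply, Matrix.transpose_map, Rat.coe_castHom,
      ratCast_map_intCast_map] using h
  rw [k3Form_eq_dotProduct, k3Form_eq_dotProduct, ← Matrix.vecMul_transpose (g.map _) a]
  simp only [Matrix.dotProduct_mulVec, Matrix.vecMul_vecMul, hC]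

/-- Rational matrices commute with complex conjugation on `Λ_ℂ`. [folklore] -/
theorem star_ratCast_map_mulVec (g : Matrix K3Index K3Index ℚ) (x : K3Index → ℂ) :
    star (g.map (Rat.cast : ℚ → ℂ) *ᵥ x) = g.map (Rat.cast : ℚ → ℂ) *ᵥ star x := by
  funext i
  simp only [Pi.star_apply, Matrix.mulVec, dotProduct, Matrix.map_apply, star_sum, star_mul',
    Complex.star_def, map_ratCast]

/-- Rational matrices act compatibly with `Λ = ℤ²² ⊂ ℚ²² ⊂ ℂ²²`. [folklore] -/
theorem ratCast_map_mulVec_intCast (g : Matrix K3Index K3Index ℚ) (v : K3Index → ℤ) :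
    g.map (Rat.cast : ℚ → ℂ) *ᵥ (fun i => (v i : ℂ)) =
      fun i => (((g *ᵥ fun j => (v j : ℚ)) i : ℚ) : ℂ) := by
  funext i
  simp only [Matrix.mulVec, dotProduct, Matrix.map_apply, Rat.cast_sum, Rat.cast_mul,
    Rat.cast_intCast]

/-! ### Card 2 `two-adic-isogeny-bootstrap`: strong approximation for `O(Λ[1/2])` + one anchor
family per degree + 2-power isogenies as (twisted) rank-2 Mukai moduli -/

/-- (B3) FIRST LEMMA of card 2 — **the stabiliser of `h` in the 2-arithmetic group `O(Λ[1/2])` acts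
on the polarised period domain `D_h` with ALL orbits dense (modulo `ℂˣ`)**: O'Meara, *Introduction to
Quadratic Forms* §104:4 (Strong Approximation for Rotations, spot `2` omitted, `T = {∞} ∪ {p ∣ h²}`)
applied to `h^⊥ ⊗ ℚ` (dim 21 ≥ 3, indefinite, isotropic at 2), plus one component-swapping element
of `O(Λ)_h` (Eichler). Elementary arithmetic of quadratic forms; no Ratner, no K3 geometry. -/
theorem stub_twoadic_density :
    ∀ h : K3Index → ℤ, 0 < ∑ i, ∑ j, h i * k3Gram i j * h j →
      ∀ x ∈ polarisedPeriodDomain h, ∀ y ∈ polarisedPeriodDomain h, ∀ ε : ℝ, 0 < ε →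
        ∃ (g : Matrix K3Index K3Index ℚ) (c : ℂ), IsRatIsometry g ∧ IsTwoIntegral g ∧
          g *ᵥ (fun i => (h i : ℚ)) = (fun i => (h i : ℚ)) ∧ c ≠ 0 ∧
          dist (c • (g.map (Rat.cast : ℚ → ℂ) *ᵥ x)) y < ε := by
  sorry

/-- (B2) **One anchor family per degree**: for every lattice vector `h` of positive square there is
an `h`-polarised algebraic Kuranishi family of marked projective K3 surfaces (tree structure
`PolarisedK3KuranishiFamily`: smooth 19-dimensional base, local Torelli at every point) with
non-empty marked locus — e.g. through the elliptic K3 with section polarised by `s + (d+1)f`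
(Huybrechts Ch. 5 Prop. 3.1 / Cor. 3.6, Ch. 6 Cor. 2.7, Prop. 2.8, §2.4, §4.1). -/
theorem stub_anchorFamily :
    ∀ h : K3Index → ℤ, 0 < ∑ i, ∑ j, h i * k3Gram i j * h j →
      ∃ (𝒮 B : Motives.SchemeOver ℂ) (π : 𝒮 ⟶ B) (U : Set (Motives.ComplexPoints B))
        (_ : PolarisedK3KuranishiFamily π U h), U.Nonempty := by
  sorry

/-- (B4) **2-power isogeny closure** — the research-grade stub of card 2: the set of realised period
vectors is stable under the 2-arithmetic group `O(Λ[1/2])`; i.e. if `(Λ, x)` is the marked Hodge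
lattice of a projective K3 surface `S`, so is `(Λ, g x)` ≅ `(g⁻¹Λ, x)` for every dyadic rational
isometry `g` — to be proved by realising Kneser 2-neighbour steps as moduli of (twisted) rank-2
sheaves on `S` (Mukai 1987; Căldăraru 2002; Yoshioka 2006; van Geemen 2005 §9 for ρ = 1, h² = 2). -/
theorem stub_twoIsogenyClosure :
    ∀ (g : Matrix K3Index K3Index ℚ), IsRatIsometry g → IsTwoIntegral g →
      ∀ x : K3Index → ℂ, Realised x ↔ Realised (g.map (Rat.cast : ℚ → ℂ) *ᵥ x) := by
  sorry

/-- COMPOSITION of card 2: B2 + B3 + B4 ⇒ the crux (glue: `conclusion_smul`,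
`PolarisedK3KuranishiFamily.exists_isOpen_forall_exists_period`, and that dyadic isometries fixing
`h` preserve `D_h`). To be proved at crux-plan. -/
theorem K3PeriodSurjective_of_twoadic
    (hB2 : ∀ h : K3Index → ℤ, 0 < ∑ i, ∑ j, h i * k3Gram i j * h j →
      ∃ (𝒮 B : Motives.SchemeOver ℂ) (π : 𝒮 ⟶ B) (U : Set (Motives.ComplexPoints B))
        (_ : PolarisedK3KuranishiFamily π U h), U.Nonempty)
    (hB3 : ∀ h : K3Index → ℤ, 0 < ∑ i, ∑ j, h i * k3Gram i j * h j →
      ∀ x ∈ polarisedPeriodDomain h, ∀ y ∈ polarisedPeriodDomain h, ∀ ε : ℝ, 0 < ε →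
        ∃ (g : Matrix K3Index K3Index ℚ) (c : ℂ), IsRatIsometry g ∧ IsTwoIntegral g ∧
          g *ᵥ (fun i => (h i : ℚ)) = (fun i => (h i : ℚ)) ∧ c ≠ 0 ∧
          dist (c • (g.map (Rat.cast : ℚ → ℂ) *ᵥ x)) y < ε)
    (hB4 : ∀ (g : Matrix K3Index K3Index ℚ), IsRatIsometry g → IsTwoIntegral g →
      ∀ x : K3Index → ℂ, Realised x ↔ Realised (g.map (Rat.cast : ℚ → ℂ) *ᵥ x)) :
    Theses.NikulinTwinTransport.K3PeriodSurjective := by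
  rw [crux_iff]
  intro x hxx hpos hv
  obtain ⟨v, hvx, hvv⟩ := hv
  obtain ⟨𝒮, B, π, U, F, b₀, hb₀⟩ := hB2 v hvv
  -- an open set of realised periods around the anchor `b₀`
  obtain ⟨V, hVo, hV0, hV⟩ := F.exists_isOpen_forall_exists_period ⟨b₀, hb₀⟩
  obtain ⟨ε, hε, hball⟩ := Metric.isOpen_iff.1 hVo _ hV0
  have hx : x ∈ polarisedPeriodDomain v := ⟨hxx, hpos, hvx⟩
  have hy0 : F.period ⟨b₀, hb₀⟩ ∈ polarisedPeriodDomain v :=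
    F.toPolarisedMarkedK3Family.period_mem_polarisedPeriodDomain ⟨b₀, hb₀⟩
  -- density: move `x` into the ball by a dyadic isometry fixing `v`
  obtain ⟨g, c, hg, h2, hgv, hc, hdist⟩ := hB3 v hvv x hx _ hy0 ε hε
  have hzV : c • (g.map (Rat.cast : ℚ → ℂ) *ᵥ x) ∈ V := hball (Metric.mem_ball.2 hdist)
  have hzD : c • (g.map (Rat.cast : ℚ → ℂ) *ᵥ x) ∈ polarisedPeriodDomain v := by
    refine smul_mem_polarisedPeriodDomain ⟨?_, ?_, ?_⟩ hc
    · rw [k3Form_ratMulVec_of_isometry hg, hxx]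
    · rw [star_ratCast_map_mulVec, k3Form_ratMulVec_of_isometry hg]
      exact hpos
    · have hgv' : g.map (Rat.cast : ℚ → ℂ) *ᵥ (fun i => (v i : ℂ)) = fun i => (v i : ℂ) := by
        rw [ratCast_map_mulVec_intCast, hgv]
        funext i
        simp only [Rat.cast_intCast]
      rw [← hgv', k3Form_ratMulVec_of_isometry hg, hvx]
  obtain ⟨b', t, ht, hper⟩ := hV _ hzV hzD
  -- the fibre over `b'` realises `t • c • g x`
  have hRb : Realised (F.period b') :=
    ⟨_, F.isK3 b', F.marking b', F.top b', F.isMarkedK3 b'⟩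
  rw [hper, smul_smul] at hRb
  have hRg : Realised (g.map (Rat.cast : ℚ → ℂ) *ᵥ x) := by
    have h' := Huybrechts_K3_periodSurjective_projective.conclusion_smul (t := (t * c)⁻¹)
      (inv_ne_zero (mul_ne_zero ht hc)) hRb
    rwa [smul_smul, inv_mul_cancel₀ (mul_ne_zero ht hc), one_smul] at h'
  -- 2-power isogeny closure pulls back along `g`
  exact (hB4 g hg h2 x).2 hRg

/-! ### Card 3 `kulikov-properness`: open + closed (smooth filling of finite-monodromy projective
degenerations) + connected -/

/-- (K0) FIRST LEMMA of card 3 — **each polarised period domain `D_h` is path-connected up to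
complex conjugation** (the two components of `SO(2,19)/SO(2)×SO(19)` are swapped by `x ↦ x̄`;
Huybrechts Ch. 6 §1.1–1.3, Prop. 1.5). Needed ONLY by the open-closed argument of this card. -/
theorem stub_polarisedPeriodDomain_connected :
    ∀ h : K3Index → ℤ, 0 < ∑ i, ∑ j, h i * k3Gram i j * h j →
      ∀ x ∈ polarisedPeriodDomain h, ∀ y ∈ polarisedPeriodDomain h,
        JoinedIn (polarisedPeriodDomain h) x y ∨ JoinedIn (polarisedPeriodDomain h) x (star y) := by
  sorry

/-- (K2) **Properness = smooth filling** in the form the open-closed argument consumes: inside `D_h`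
the realised set is CLOSED (Kulikov 1977 / Persson–Pinkham 1981 / Friedman 1984: a projective
degeneration of polarised K3 surfaces with finite monodromy on `H²` has, after base change, a
smooth filling; modern proof: KKMS semistable reduction + Kulikov–Persson–Pinkham via MMP, KLSV 2018
§5; Huybrechts Ch. 6 Thm. 5.3). -/
theorem stub_realised_closed_in_polarisedDomain :
    ∀ h : K3Index → ℤ, 0 < ∑ i, ∑ j, h i * k3Gram i j * h j →
      IsClosed {x | x ∈ polarisedPeriodDomain h ∧ Realised x} ∨
      -- closed RELATIVE to `D_h` (which is itself not closed in `Λ_ℂ`):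
      ∃ C : Set (K3Index → ℂ), IsClosed C ∧ C ∩ polarisedPeriodDomain h =
        {x | x ∈ polarisedPeriodDomain h ∧ Realised x} := by
  sorry

end Summit.HodgeConjecture.HodgeConjecture.Cruxes.K3PeriodSurjective.IdeatorTwoSketch

end
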